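import Mathlib
import HarnessLib
import Literature.Probability.MarkovChains.MultiplicativeReversibilization
import Literature.Probability.MarkovChains.CheegerInequality
import Literature.Probability.MarkovChains.LpDistance

/-!
# The spectral profile bound in discrete time — `d²_{2,π}(K_n(x,·),π) ≤ 4/V_{KK*}(n/2)` and the lazy-chain corollary `V_{KK*}(t/2) ≥ V(αt)` (Goel–Montenegro–Tetali 2006, Theorem 2.2, Corollary 2.1)

HONEST FRAMING: exact (Metropolis-corrected) sampling algorithms for lattice gauge theory; figures
of merit are autocorrelation/cost numbers at stated couplings and volumes; no continuum-physics claim.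

Source (READ on the hub's materialised text, §2.3 "Discrete time", p. 7): S. Goel, R. Montenegro,
P. Tetali, *Mixing time bounds via the spectral profile*, Electron. J. Probab. **11** (2006) 1–26 =
math.PR/0505690 [GoelMontenegroTetali2006]: THEOREM 2.2 with its proof ("`I_x(n+1) − I_x(n) =
−𝓔_{KK*}(u_{x,n},u_{x,n}) ≤ −½I_x(n)Λ_{KK*}(4/I_x(n))` … `V_{KK*}(t/2) ≤ 4/I_x(t)`") and the `L²`
half of the proof of COROLLARY 2.1 ("`KK*(x,y)π(x) ≥ K*(x,x)K(x,y)π(x) + K*(x,y)K(y,y)π(x) ≥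
αK(x,y)π(x) + αK(y,x)π(y)` and so `𝓔_{KK*}(f,f) ≥ 2α𝓔_K(f,f)` … Accordingly `V_{KK*}(t/2) ≥ V(αt)`").
Everything below is PROVED (finite sums and one real integral; 0 named facts).

VOCABULARY (all the tree's): `K = P` row-stochastic, `π` its stationary positive probability
vector; `KK* = mulReversibilization π P` (`MultiplicativeReversibilization.lean`, whose (9.36)
`𝓔_{KK*}(u) = ‖u‖²_π − ‖K*u‖²_π` and `ρ_{n+1} − 1 = K*(ρ_n − 1)` ARE eq. (discrete-diff)); `ρ_n =
lawAt P ν n / π` is the density of `νKⁿ`, `I(n) = ‖ρ_n − 1‖²_{2,π} = piInner π (ρ_n − 1) (ρ_n − 1)`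
(`= Var_π ρ_n`; for `ν = δ_x`, `ρ_n = k(x,·,n)` and `sup_x d_{2,π}(K_n(x,·),π) = lTwoDist P π n`,
`LpDistance.lean`); `𝓔 = dirichletForm`, `Var = lawVariance`, `E = lawMean`.  The printed statement is
the point start `ν = δ_x`; its proof uses only `u_n ≥ 0`, `E u_n = 1` and runs verbatim for any
initial law `ν`, which is how the recursion is typed (the `δ_x` form is a one-line specialisation).

THE PROFILE IS A PARAMETER (as in `SpectralProfileHeatKernelBound.lean`): `Λ : ℝ → ℝ` with, on a ray
`[a,∞)` (`0 < a`, `a·I(0) ≤ 4`; printed `a = 4π_*`, `I_x(0) = (1 − π(x))/π(x)`): (FK) `𝓔_{KK*}(u,u)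
≥ ½Λ(4(Eu)²/Var u)·Var u` for non-constant `u ≥ 0` (LEMMA 2.1 for `Λ = Λ_{KK*}`), (M) non-increasing,
(P) `Λ ≥ m > 0`.  `V_{KK*}` is not introduced: the conclusion is typed as `n/2 ≤ ∫_a^{4/I(n)}
dv/(vΛ(v))` and in the `ε`-form.  DECLARED DEVIATION (a shorter road to the same inequality): the
source integrates `I(n+1) − I(n) ≤ −½I(n)Λ(4/I(n))` through the piecewise linear extension of `I`
and the ODE comparison of THEOREM 2.1; here each step is integrated directly — on `[4/I(n),
4/I(n+1)]`, `Λ(v) ≤ Λ(4/I(n))`, so `∫ dv/(vΛ(v)) ≥ log(I(n)/I(n+1))/Λ(4/I(n)) ≥ (1 − I(n+1)/I(n))/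
Λ(4/I(n)) ≥ ½`.

## Content
* `lawMean_lawAt_div` (`E_π ρ_n = 1`), `piInner_sub_one_eq_lawVariance` (`‖ρ − 1‖² = Var ρ` when
  `Eρ = 1`), **eq. (discrete-diff)** `GoelMontenegroTetali2006_discreteDiff` (`I(n+1) = I(n) −
  𝓔_{KK*}(ρ_n,ρ_n)`; with the tree's `dirichletForm_sub_const`), `chiSq_lawAt_succ_le`, `chiSq_lawAt_le_zero`;
* the step, integrated: `log_div_le_mul_integral_inv_mul_profile` (`log(d/c) ≤ Λ(c)∫_c^d dv/(vΛ(v))`),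
  `GoelMontenegroTetali2006_half_le_integral_step`;
* **THEOREM 2.2**: `GoelMontenegroTetali2006_thm_2_2_of_faberKrahn` (`n/2 ≤ ∫_a^{4/I(n)} dv/(vΛ(v))`,
  any initial law), `GoelMontenegroTetali2006_thm_2_2_chiSq` (`∫_a^{4/ε} ≤ n/2 ⇒ I(n) ≤ ε`) and the
  printed form `GoelMontenegroTetali2006_thm_2_2` (`a ≤ 4π_*`: `sup_x d_{2,π}(K_n(x,·),π) ≤ √ε`);
* **COROLLARY 2.1 (its `L²` half)**: `dirichletForm_mulReversibilization_ge_of_diag` (`K(x,x) ≥ α ⇒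
  𝓔_{KK*} ≥ 2α𝓔_K`; `α = ½` is Fill's lazy-chain lemma of `MultiplicativeReversibilization.lean`) and
  `GoelMontenegroTetali2006_cor_2_1_lTwo` (`∫_a^{4/ε} dv/(vΛ_K(v)) ≤ αn ⇒ sup_x d_{2,π}(K_n(x,·),π) ≤ √ε`).

NOT HERE (scope, value-free): the `L^∞` conclusion of COROLLARY 2.1 (`τ_∞(ε) ≤ 2⌈∫dv/(αvΛ(v))⌉` via
`|k(x,y,2n) − 1| ≤ d_{2,π}(K_n(x,·),π)·d_{2,π}(K*_n(y,·),π)`), the `K*K` twin (the same theorem for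
`K*`), COROLLARY 2.2, the rescaling remark, the specialisation `Λ = Λ_{KK*}` (`SpectralProfile.lean`).
-/

namespace Literature.Probability.MarkovChains

open Finset Matrix Set MeasureTheory intervalIntegral

variable {X : Type*} [Fintype X] [DecidableEq X] {P : Matrix X X ℝ} {π : X → ℝ} {Λ : ℝ → ℝ} {a m : ℝ}

/-! ## Densities and eq. (discrete-diff) -/

section DiscreteDiff

omit [DecidableEq X] in
/-- `E_π ρ_n = Σ_y (νKⁿ)(y) = 1` for a probability vector `ν`. [cite: GoelMontenegroTetali2006, §2.3
proof of Theorem 2.2 (Lemma 2.1 applies to `u_{x,n}`: `E u_{x,n} = 1`)] -/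
theorem lawMean_lawAt_div (hP : IsRowStochastic P) (hπ : ∀ y, 0 < π y) {ν : X → ℝ}
    (hν1 : ∑ y, ν y = 1) (n : ℕ) : lawMean π (fun y => lawAt P ν n y / π y) = 1 := by
  unfold lawMean
  rw [← hν1, ← sum_lawAt hP ν n]
  exact sum_congr rfl fun y _ => mul_div_cancel₀ _ (hπ y).ne'

omit [DecidableEq X] in
/-- `‖ρ − 1‖²_{2,π} = Var_π(ρ)` when `E_π ρ = 1` (`I_x(n) = Var(u_{x,n}) = d²_{2,π}(K_n(x,·),π)`).
[cite: GoelMontenegroTetali2006, §1.1 (definition of `d_{2,π}`) and §2.3 proof of Theorem 2.2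
(`I_x(n) = Var(u_{x,n})`)] -/
theorem piInner_sub_one_eq_lawVariance (hπ1 : ∑ y, π y = 1) {ρ : X → ℝ} (hρ : lawMean π ρ = 1) :
    piInner π (fun y => ρ y - 1) (fun y => ρ y - 1) = lawVariance π ρ := by
  rw [piInner_sub_const_eq hπ1 ρ 1, hρ, sub_self, zero_pow two_ne_zero, add_zero]

omit [DecidableEq X] in
/-- **Eq. (discrete-diff): `I(n+1) − I(n) = −𝓔_{KK*}(ρ_n,ρ_n)`** for the densities `ρ_n = νKⁿ/π`
and `I(n) = ‖ρ_n − 1‖²_{2,π}` — from `ρ_{n+1} − 1 = K*(ρ_n − 1)` and `‖K*g‖² = ‖g‖² − 𝓔_{KK*}(g,g)`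
((9.36) of `MultiplicativeReversibilization.lean`). [cite: GoelMontenegroTetali2006, §2.3 proof of
Theorem 2.2, first display ("By (discrete-diff) … `I_x(n+1) − I_x(n) = −𝓔_{KK*}(u_{x,n},u_{x,n})`")] -/
theorem GoelMontenegroTetali2006_discreteDiff (hπ : ∀ y, 0 < π y) (hP : IsRowStochastic P)
    (hst : IsStationary π P) (ν : X → ℝ) (n : ℕ) :
    piInner π (fun y => lawAt P ν (n + 1) y / π y - 1) (fun y => lawAt P ν (n + 1) y / π y - 1) =
      piInner π (fun y => lawAt P ν n y / π y - 1) (fun y => lawAt P ν n y / π y - 1) -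
        dirichletForm π (mulReversibilization π P) (fun y => lawAt P ν n y / π y) := by
  rw [lawAt_succ, stepLaw_div_sub_one hπ hst,
    ← dirichletForm_sub_const π (mulReversibilization π P) (fun y => lawAt P ν n y / π y) 1,
    dirichletForm_mulReversibilization hπ hP hst]
  ring

omit [DecidableEq X] in
/-- `I(n+1) ≤ I(n)` ("`I_x(n)` is non-increasing"). [cite: GoelMontenegroTetali2006, §2.3 proof of
Theorem 2.2] -/
theorem chiSq_lawAt_succ_le (hπ : ∀ y, 0 < π y) (hP : IsRowStochastic P) (hst : IsStationary π P)
    (ν : X → ℝ) (n : ℕ) :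
    piInner π (fun y => lawAt P ν (n + 1) y / π y - 1) (fun y => lawAt P ν (n + 1) y / π y - 1) ≤
      piInner π (fun y => lawAt P ν n y / π y - 1) (fun y => lawAt P ν n y / π y - 1) := by
  rw [GoelMontenegroTetali2006_discreteDiff hπ hP hst ν n]
  linarith [dirichletForm_nonneg (fun y => (hπ y).le) (mulReversibilization_nonneg hπ hP.1)
    (fun y => lawAt P ν n y / π y)]

omit [DecidableEq X] in
/-- `I(n) ≤ I(0)`. [cite: GoelMontenegroTetali2006, §2.3 proof of Theorem 2.2 ("non-increasing")] -/
theorem chiSq_lawAt_le_zero (hπ : ∀ y, 0 < π y) (hP : IsRowStochastic P) (hst : IsStationary π P)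
    (ν : X → ℝ) (n : ℕ) :
    piInner π (fun y => lawAt P ν n y / π y - 1) (fun y => lawAt P ν n y / π y - 1) ≤
      piInner π (fun y => ν y / π y - 1) (fun y => ν y / π y - 1) := by
  induction n with
  | zero => rw [lawAt_zero]
  | succ n ih => exact (chiSq_lawAt_succ_le hπ hP hst ν n).trans ih

end DiscreteDiff

/-! ## One step of the recursion, integrated -/

section Step

/-- `v ↦ 1/(vΛ(v))` is integrable on `[c,d] ⊆ [a,∞)` (bounded by `1/(am)`, measurable through the
monotone regularisation `v ↦ Λ(max v a)`). [cite: GoelMontenegroTetali2006, §1.1 (`∫ dr/(rΛ(r))`)] -/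
private theorem integrableOn_inv_mul_profile (ha : 0 < a) (hm : 0 < m)
    (hΛm : ∀ v, a ≤ v → m ≤ Λ v) (hΛanti : AntitoneOn Λ (Ici a)) {c d : ℝ} (hc : a ≤ c) :
    IntegrableOn (fun v => (v * Λ v)⁻¹) (Icc c d) := by
  set L : ℝ → ℝ := fun v => Λ (max v a) with hL
  have hLanti : Antitone L := fun u v huv =>
    hΛanti (mem_Ici.2 (le_max_right u a)) (mem_Ici.2 (le_max_right v a)) (max_le_max huv le_rfl)
  have h1 : IntegrableOn (fun v => (v * L v)⁻¹) (Icc c d) := by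
    refine Integrable.mono' (integrable_const ((a * m)⁻¹))
      ((measurable_id.mul hLanti.measurable).inv.aestronglyMeasurable) ?_
    filter_upwards [ae_restrict_mem measurableSet_Icc] with v hv
    have hav : a ≤ v := hc.trans hv.1
    have hLm : m ≤ L v := hΛm _ (le_max_right v a)
    rw [Real.norm_eq_abs, abs_of_nonneg (inv_nonneg.2 (mul_nonneg (ha.le.trans hav) (hm.le.trans hLm)))]
    exact inv_anti₀ (mul_pos ha hm) (mul_le_mul hav hLm hm.le (ha.le.trans hav))
  refine h1.congr_fun (fun v hv => ?_) measurableSet_Icc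
  show (v * L v)⁻¹ = (v * Λ v)⁻¹
  simp [hL, max_eq_left (hc.trans hv.1)]

/-- The same on an interval `[c,d]`, `a ≤ c ≤ d`. [cite: GoelMontenegroTetali2006, §1.1] -/
private theorem intervalIntegrable_of_le (ha : 0 < a) (hm : 0 < m)
    (hΛm : ∀ v, a ≤ v → m ≤ Λ v) (hΛanti : AntitoneOn Λ (Ici a)) {c d : ℝ} (hc : a ≤ c)
    (hcd : c ≤ d) : IntervalIntegrable (fun v => (v * Λ v)⁻¹) volume c d :=
  ((integrableOn_inv_mul_profile ha hm hΛm hΛanti hc (d := d)).mono_set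
    (by rw [uIcc_of_le hcd])).intervalIntegrable

/-- **`log(d/c) ≤ Λ(c)·∫_c^d dv/(vΛ(v))`** for `a ≤ c ≤ d` (`Λ(v) ≤ Λ(c)` on `[c,d]`, `∫_c^d dv/v =
log(d/c)`). [cite: GoelMontenegroTetali2006, §2.3 proof of Theorem 2.2 ("Solving this differential
equation as in Theorem 2.1" — the step integrated directly, see the module docstring)] -/
theorem log_div_le_mul_integral_inv_mul_profile (ha : 0 < a) (hm : 0 < m)
    (hΛm : ∀ v, a ≤ v → m ≤ Λ v) (hΛanti : AntitoneOn Λ (Ici a)) {c d : ℝ} (hc : a ≤ c)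
    (hcd : c ≤ d) : Real.log (d / c) ≤ Λ c * ∫ v in c..d, (v * Λ v)⁻¹ := by
  have hc0 : 0 < c := ha.trans_le hc
  have hii := intervalIntegrable_of_le ha hm hΛm hΛanti hc hcd
  have hmono : ∫ v in c..d, v⁻¹ ≤ ∫ v in c..d, Λ c * (v * Λ v)⁻¹ := by
    refine intervalIntegral.integral_mono_on hcd ?_ (hii.const_mul _) fun v hv => ?_
    · refine intervalIntegral.intervalIntegrable_inv (fun v hv => ?_) continuousOn_id
      exact (hc0.trans_le (by rw [uIcc_of_le hcd] at hv; exact hv.1)).ne'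
    · have hv0 : 0 < v := hc0.trans_le hv.1
      have hΛv : 0 < Λ v := hm.trans_le (hΛm v (hc.trans hv.1))
      have hΛvc : Λ v ≤ Λ c := hΛanti (mem_Ici.2 hc) (mem_Ici.2 (hc.trans hv.1)) hv.1
      rw [mul_inv, mul_left_comm]
      exact le_mul_of_one_le_right (inv_nonneg.2 hv0.le)
        (by rw [← div_eq_mul_inv, one_le_div hΛv]; exact hΛvc)
  rwa [integral_inv_of_pos hc0 (hc0.trans_le hcd), intervalIntegral.integral_const_mul] at hmono

/-- **One step**: if `0 < J ≤ I`, `a ≤ 4/I` and `J ≤ I − ½IΛ(4/I)` (eq. (discrete-diff) with (FK)),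
then **`½ ≤ ∫_{4/I}^{4/J} dv/(vΛ(v))`** (`Λ(4/I)∫ ≥ log(I/J) ≥ 1 − J/I ≥ ½Λ(4/I)`).
[cite: GoelMontenegroTetali2006, §2.3 proof of Theorem 2.2] -/
theorem GoelMontenegroTetali2006_half_le_integral_step (ha : 0 < a) (hm : 0 < m)
    (hΛm : ∀ v, a ≤ v → m ≤ Λ v) (hΛanti : AntitoneOn Λ (Ici a)) {I J : ℝ} (hJ : 0 < J)
    (hJI : J ≤ I) (haI : a ≤ 4 / I) (hrec : J ≤ I - (1 / 2) * I * Λ (4 / I)) :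
    1 / 2 ≤ ∫ v in (4 / I)..(4 / J), (v * Λ v)⁻¹ := by
  have hI : 0 < I := hJ.trans_le hJI
  have hΛI : 0 < Λ (4 / I) := hm.trans_le (hΛm _ haI)
  have hcd : 4 / I ≤ 4 / J := div_le_div_of_nonneg_left (by norm_num) hJ hJI
  have h1 := log_div_le_mul_integral_inv_mul_profile ha hm hΛm hΛanti haI hcd
  rw [show 4 / J / (4 / I) = I / J by field_simp] at h1
  have h2 : 1 - J / I ≤ Real.log (I / J) := by
    have h := Real.add_one_le_exp (-Real.log (I / J))
    rw [Real.exp_neg, Real.exp_log (div_pos hI hJ), inv_div] at h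
    linarith
  have h3 : (1 / 2) * Λ (4 / I) ≤ 1 - J / I := by
    have : J / I ≤ 1 - (1 / 2) * Λ (4 / I) := by
      rw [div_le_iff₀ hI]; nlinarith
    linarith
  by_contra hcon
  have : Λ (4 / I) * ∫ v in (4 / I)..(4 / J), (v * Λ v)⁻¹ < Λ (4 / I) * (1 / 2) :=
    mul_lt_mul_of_pos_left (not_le.1 hcon) hΛI
  nlinarith

end Step

section TheoremTwoTwo

omit [DecidableEq X] in
/-- **THEOREM 2.2 (Goel–Montenegro–Tetali 2006), the summed recursion, for any initial law.**  `K`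
row-stochastic with stationary positive probability vector `π`; `Λ` with (FK) for `KK*`, (M), (P) on
`[a,∞)`, `0 < a`, `a·I(0) ≤ 4`; `ν` a probability vector, `I(n) = ‖νKⁿ/π − 1‖²_{2,π}`.  Then for every
`n` with `I(n) > 0`: **`n/2 ≤ ∫_a^{4/I(n)} dv/(vΛ(v))`** (i.e. `V_{KK*}(n/2) ≤ 4/I(n)`).
[cite: GoelMontenegroTetali2006, §2.3 Theorem 2.2 (statement and proof)] -/
theorem GoelMontenegroTetali2006_thm_2_2_of_faberKrahn (hπ : ∀ y, 0 < π y) (hπ1 : ∑ y, π y = 1)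
    (hP : IsRowStochastic P) (hst : IsStationary π P) (ha : 0 < a) (hm : 0 < m)
    (hΛm : ∀ v, a ≤ v → m ≤ Λ v) (hΛanti : AntitoneOn Λ (Ici a))
    (hFK : ∀ u : X → ℝ, (∀ y, 0 ≤ u y) → 0 < lawVariance π u →
      (1 / 2) * Λ (4 * lawMean π u ^ 2 / lawVariance π u) * lawVariance π u ≤
        dirichletForm π (mulReversibilization π P) u)
    {ν : X → ℝ} (hν0 : ∀ y, 0 ≤ ν y) (hν1 : ∑ y, ν y = 1)
    (haν : a * piInner π (fun y => ν y / π y - 1) (fun y => ν y / π y - 1) ≤ 4) :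
    ∀ n : ℕ, 0 < piInner π (fun y => lawAt P ν n y / π y - 1) (fun y => lawAt P ν n y / π y - 1) →
      (n : ℝ) / 2 ≤ ∫ v in a..(4 / piInner π (fun y => lawAt P ν n y / π y - 1)
        (fun y => lawAt P ν n y / π y - 1)), (v * Λ v)⁻¹ := by
  set I : ℕ → ℝ := fun n =>
    piInner π (fun y => lawAt P ν n y / π y - 1) (fun y => lawAt P ν n y / π y - 1) with hI
  have haI : ∀ n, 0 < I n → a ≤ 4 / I n := fun n hn => by
    rw [le_div_iff₀ hn]
    exact (mul_le_mul_of_nonneg_left (chiSq_lawAt_le_zero hπ hP hst ν n) ha.le).trans haν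
  intro n
  induction n with
  | zero =>
    intro h0
    rw [Nat.cast_zero, zero_div]
    exact intervalIntegral.integral_nonneg (haI 0 h0) fun v hv =>
      inv_nonneg.2 (mul_nonneg (ha.le.trans hv.1) (hm.le.trans (hΛm v hv.1)))
  | succ n ih =>
    intro hJ
    have hmono : I (n + 1) ≤ I n := chiSq_lawAt_succ_le hπ hP hst ν n
    have hIn : 0 < I n := hJ.trans_le hmono
    have hvar : lawVariance π (fun y => lawAt P ν n y / π y) = I n :=
      (piInner_sub_one_eq_lawVariance hπ1 (lawMean_lawAt_div hP hπ hν1 n)).symm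
    have hrec : I (n + 1) ≤ I n - (1 / 2) * I n * Λ (4 / I n) := by
      have h := hFK _ (fun y => div_nonneg (lawAt_nonneg hP hν0 n y) (hπ y).le) (hvar ▸ hIn)
      rw [lawMean_lawAt_div hP hπ hν1 n, hvar, one_pow, mul_one] at h
      have e : I (n + 1) = I n - _ := GoelMontenegroTetali2006_discreteDiff hπ hP hst ν n
      rw [e]; linarith
    have hstep := GoelMontenegroTetali2006_half_le_integral_step ha hm hΛm hΛanti hJ hmono
      (haI n hIn) hrec
    have hc2 : 4 / I n ≤ 4 / I (n + 1) := div_le_div_of_nonneg_left (by norm_num) hJ hmono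
    rw [← intervalIntegral.integral_add_adjacent_intervals
      (intervalIntegrable_of_le ha hm hΛm hΛanti le_rfl (haI n hIn))
      (intervalIntegrable_of_le ha hm hΛm hΛanti (haI n hIn) hc2)]
    push_cast
    linarith [ih hIn]

omit [DecidableEq X] in
/-- **THEOREM 2.2, `ε`-form, any initial law**: under the same hypotheses, for `ε > 0`,
**`∫_a^{4/ε} dv/(vΛ(v)) ≤ n/2` implies `‖νKⁿ/π − 1‖²_{2,π} ≤ ε`** (`d²_{2,π} ≤ 4/V_{KK*}(n/2)` typed
without the inverse function `V`). [cite: GoelMontenegroTetali2006, §2.3 Theorem 2.2] -/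
theorem GoelMontenegroTetali2006_thm_2_2_chiSq (hπ : ∀ y, 0 < π y) (hπ1 : ∑ y, π y = 1)
    (hP : IsRowStochastic P) (hst : IsStationary π P) (ha : 0 < a) (hm : 0 < m)
    (hΛm : ∀ v, a ≤ v → m ≤ Λ v) (hΛanti : AntitoneOn Λ (Ici a))
    (hFK : ∀ u : X → ℝ, (∀ y, 0 ≤ u y) → 0 < lawVariance π u →
      (1 / 2) * Λ (4 * lawMean π u ^ 2 / lawVariance π u) * lawVariance π u ≤
        dirichletForm π (mulReversibilization π P) u)
    {ν : X → ℝ} (hν0 : ∀ y, 0 ≤ ν y) (hν1 : ∑ y, ν y = 1)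
    (haν : a * piInner π (fun y => ν y / π y - 1) (fun y => ν y / π y - 1) ≤ 4) {n : ℕ} {ε : ℝ}
    (hε : 0 < ε) (hint : ∫ v in a..(4 / ε), (v * Λ v)⁻¹ ≤ (n : ℝ) / 2) :
    piInner π (fun y => lawAt P ν n y / π y - 1) (fun y => lawAt P ν n y / π y - 1) ≤ ε := by
  by_contra hcon; rw [not_le] at hcon
  set In := piInner π (fun y => lawAt P ν n y / π y - 1) (fun y => lawAt P ν n y / π y - 1)
  have hI : 0 < In := hε.trans hcon
  have hmain := GoelMontenegroTetali2006_thm_2_2_of_faberKrahn hπ hπ1 hP hst ha hm hΛm hΛanti hFK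
    hν0 hν1 haν n hI
  have haI : a ≤ 4 / In := by
    rw [le_div_iff₀ hI]
    exact (mul_le_mul_of_nonneg_left (chiSq_lawAt_le_zero hπ hP hst ν n) ha.le).trans haν
  have hlt : 4 / In < 4 / ε := div_lt_div_of_pos_left (by norm_num) hε hcon
  have hpos : 0 < ∫ v in (4 / In)..(4 / ε), (v * Λ v)⁻¹ :=
    (mul_pos_iff_of_pos_left (hm.trans_le (hΛm _ haI))).1
      ((Real.log_pos ((one_lt_div (div_pos (by norm_num) hI)).2 hlt)).trans_le
        (log_div_le_mul_integral_inv_mul_profile ha hm hΛm hΛanti haI hlt.le))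
  linarith [intervalIntegral.integral_add_adjacent_intervals
    (intervalIntegrable_of_le ha hm hΛm hΛanti le_rfl haI)
    (intervalIntegrable_of_le ha hm hΛm hΛanti haI hlt.le)]

/-- **THEOREM 2.2 (Goel–Montenegro–Tetali 2006), printed form `sup_x d²_{2,π}(K_n(x,·),π) ≤
4/V_{KK*}(n/2)`**, typed without `V`: with (FK) for `KK*`, (M), (P) on `[a,∞)`, `0 < a ≤ 4π_*`
(`I_x(0) = (1 − π(x))/π(x)`), for `ε > 0`: **`∫_a^{4/ε} dv/(vΛ(v)) ≤ n/2` implies `d⁽²⁾(n) =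
sup_x ‖k(x,·,n) − 1‖_{2,π} ≤ √ε`**. [cite: GoelMontenegroTetali2006, §2.3 Theorem 2.2] -/
theorem GoelMontenegroTetali2006_thm_2_2 (hπ : ∀ y, 0 < π y) (hπ1 : ∑ y, π y = 1)
    (hP : IsRowStochastic P) (hst : IsStationary π P) (ha : 0 < a) (hm : 0 < m)
    (hΛm : ∀ v, a ≤ v → m ≤ Λ v) (hΛanti : AntitoneOn Λ (Ici a))
    (hFK : ∀ u : X → ℝ, (∀ y, 0 ≤ u y) → 0 < lawVariance π u →
      (1 / 2) * Λ (4 * lawMean π u ^ 2 / lawVariance π u) * lawVariance π u ≤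
        dirichletForm π (mulReversibilization π P) u)
    (hax : ∀ x, a ≤ 4 * π x) {n : ℕ} {ε : ℝ} (hε : 0 < ε)
    (hint : ∫ v in a..(4 / ε), (v * Λ v)⁻¹ ≤ (n : ℝ) / 2) : lTwoDist P π n ≤ Real.sqrt ε := by
  rcases isEmpty_or_nonempty X with hX | hX
  · simp only [lTwoDist, Real.iSup_of_isEmpty]; exact Real.sqrt_nonneg ε
  refine ciSup_le fun x => Real.sqrt_le_sqrt ?_
  have hν0 : ∀ y, 0 ≤ (Pi.single x 1 : X → ℝ) y := fun y => by
    rw [Pi.single_apply]; split_ifs <;> norm_num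
  have hπx1 : π x ≤ 1 := hπ1 ▸ single_le_sum (fun y _ => (hπ y).le) (mem_univ x)
  have haν : a * piInner π (fun y => (Pi.single x 1 : X → ℝ) y / π y - 1)
      (fun y => (Pi.single x 1 : X → ℝ) y / π y - 1) ≤ 4 := by
    rw [chiSq_single hπ hπ1 x, mul_div_assoc', div_le_iff₀ (hπ x)]
    nlinarith [hax x, hπ x, mul_nonneg (sub_nonneg.2 (hax x)) (sub_nonneg.2 hπx1)]
  exact GoelMontenegroTetali2006_thm_2_2_chiSq hπ hπ1 hP hst ha hm hΛm hΛanti hFK hν0 (by simp)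
    haν hε hint

end TheoremTwoTwo

section CorollaryTwoOne

omit [DecidableEq X] in
/-- **`𝓔_{KK*}(f,f) ≥ 2α𝓔_K(f,f)` when `K(x,x) ≥ α` for all `x`** ("`KK*(x,y)π(x) ≥
K*(x,x)K(x,y)π(x) + K*(x,y)K(y,y)π(x) ≥ αK(x,y)π(x) + αK(y,x)π(y)`"; `α = ½` is Fill's lazy-chain
lemma `dirichletForm_le_mulReversibilization`). [cite: GoelMontenegroTetali2006, §2.3 proof of
Corollary 2.1 (first two displays); DiaconisSaloffcoste1996Nash, §2 Lemma 2.5 eq. (2.11) (`K*K`)] -/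
theorem dirichletForm_mulReversibilization_ge_of_diag (hπ : ∀ y, 0 < π y)
    (hP0 : ∀ x y, 0 ≤ P x y) {α : ℝ} (hα : ∀ x, α ≤ P x x) (f : X → ℝ) :
    2 * α * dirichletForm π P f ≤ dirichletForm π (mulReversibilization π P) f := by
  classical
  have hpt : ∀ x y, (α * (π x * P x y) + α * (π y * P y x)) * (f x - f y) ^ 2 ≤
      π x * mulReversibilization π P x y * (f x - f y) ^ 2 := by
    intro x y
    by_cases hxy : x = y
    · subst hxy; simp
    refine mul_le_mul_of_nonneg_right ?_ (sq_nonneg _)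
    set g : X → ℝ := fun z => P x z * (π y * P y z / π z) with hg
    have hg0 : ∀ z, 0 ≤ g z := fun z =>
      mul_nonneg (hP0 x z) (div_nonneg (mul_nonneg (hπ y).le (hP0 y z)) (hπ z).le)
    have h2 : g x + g y ≤ ∑ z, g z := by
      rw [← sum_pair hxy]
      exact sum_le_sum_of_subset_of_nonneg (subset_univ _) fun z _ _ => hg0 z
    have hx0 : π x ≠ 0 := (hπ x).ne'
    have hy0 : π y ≠ 0 := (hπ y).ne'
    have e : π x * (g x + g y) = P x x * (π y * P y x) + P y y * (π x * P x y) := by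
      simp only [hg]; field_simp
    have h3 : α * (π x * P x y) + α * (π y * P y x) ≤ π x * (g x + g y) := by
      rw [e]
      nlinarith [mul_le_mul_of_nonneg_right (hα x) (mul_nonneg (hπ y).le (hP0 y x)),
        mul_le_mul_of_nonneg_right (hα y) (mul_nonneg (hπ x).le (hP0 x y))]
    rw [mulReversibilization_apply]
    exact h3.trans (mul_le_mul_of_nonneg_left h2 (hπ x).le)
  have hsymm : ∑ x, ∑ y, π y * P y x * (f x - f y) ^ 2 = ∑ x, ∑ y, π x * P x y * (f x - f y) ^ 2 := by
    rw [sum_comm]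
    exact sum_congr rfl fun x _ => sum_congr rfl fun y _ => by ring
  have e : ∑ x, ∑ y, (α * (π x * P x y) + α * (π y * P y x)) * (f x - f y) ^ 2 =
      2 * α * ∑ x, ∑ y, π x * P x y * (f x - f y) ^ 2 := by
    have : ∑ x, ∑ y, (α * (π x * P x y) + α * (π y * P y x)) * (f x - f y) ^ 2 =
        α * ∑ x, ∑ y, π x * P x y * (f x - f y) ^ 2 +
          α * ∑ x, ∑ y, π y * P y x * (f x - f y) ^ 2 := by
      rw [mul_sum, mul_sum, ← sum_add_distrib]
      refine sum_congr rfl fun x _ => ?_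
      rw [mul_sum, mul_sum, ← sum_add_distrib]
      exact sum_congr rfl fun y _ => by ring
    rw [this, hsymm]; ring
  calc 2 * α * dirichletForm π P f
      = 1 / 2 * ∑ x, ∑ y, (α * (π x * P x y) + α * (π y * P y x)) * (f x - f y) ^ 2 := by
        unfold dirichletForm; rw [e]; ring
    _ ≤ 1 / 2 * ∑ x, ∑ y, π x * mulReversibilization π P x y * (f x - f y) ^ 2 :=
        mul_le_mul_of_nonneg_left (sum_le_sum fun x _ => sum_le_sum fun y _ => hpt x y)
          (by norm_num)
    _ = dirichletForm π (mulReversibilization π P) f := rfl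

/-- **COROLLARY 2.1 (Goel–Montenegro–Tetali 2006), its `L²` half**: if `K(x,x) ≥ α > 0` for all
`x` and `Λ` satisfies (FK) for `K` itself ((M), (P) on `[a,∞)`, `0 < a ≤ 4π_*`), then `Λ_{KK*} ≥
2αΛ`, "accordingly `V_{KK*}(t/2) ≥ V(αt)`", i.e. with Theorem 2.2: **`∫_a^{4/ε} dv/(vΛ(v)) ≤ αn`
implies `sup_x d_{2,π}(K_n(x,·),π) ≤ √ε`**. [cite: GoelMontenegroTetali2006, §2.3 Corollary 2.1
(proof, through "Accordingly, `V_{KK*}(t/2) ≥ V(αt)`")] -/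
theorem GoelMontenegroTetali2006_cor_2_1_lTwo (hπ : ∀ y, 0 < π y) (hπ1 : ∑ y, π y = 1)
    (hP : IsRowStochastic P) (hst : IsStationary π P) (ha : 0 < a) (hm : 0 < m)
    (hΛm : ∀ v, a ≤ v → m ≤ Λ v) (hΛanti : AntitoneOn Λ (Ici a))
    (hFK : ∀ u : X → ℝ, (∀ y, 0 ≤ u y) → 0 < lawVariance π u →
      (1 / 2) * Λ (4 * lawMean π u ^ 2 / lawVariance π u) * lawVariance π u ≤ dirichletForm π P u)
    {α : ℝ} (hα0 : 0 < α) (hα : ∀ x, α ≤ P x x) (hax : ∀ x, a ≤ 4 * π x) {n : ℕ} {ε : ℝ}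
    (hε : 0 < ε) (hint : ∫ v in a..(4 / ε), (v * Λ v)⁻¹ ≤ α * n) :
    lTwoDist P π n ≤ Real.sqrt ε := by
  refine GoelMontenegroTetali2006_thm_2_2 (Λ := fun v => 2 * α * Λ v) (m := 2 * α * m) hπ hπ1 hP
    hst ha (by positivity) (fun v hv => mul_le_mul_of_nonneg_left (hΛm v hv) (by positivity))
    (fun u hu v hv huv => mul_le_mul_of_nonneg_left (hΛanti hu hv huv) (by positivity))
    (fun u hu hV => ?_) hax hε ?_
  · calc (1 / 2) * (2 * α * Λ (4 * lawMean π u ^ 2 / lawVariance π u)) * lawVariance π u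
        = 2 * α * ((1 / 2) * Λ (4 * lawMean π u ^ 2 / lawVariance π u) * lawVariance π u) := by
          ring
      _ ≤ 2 * α * dirichletForm π P u := mul_le_mul_of_nonneg_left (hFK u hu hV) (by positivity)
      _ ≤ dirichletForm π (mulReversibilization π P) u :=
          dirichletForm_mulReversibilization_ge_of_diag hπ hP.1 hα u
  · have e : ∫ v in a..(4 / ε), (v * (2 * α * Λ v))⁻¹ =
        (2 * α)⁻¹ * ∫ v in a..(4 / ε), (v * Λ v)⁻¹ := by
      rw [← intervalIntegral.integral_const_mul]
      refine intervalIntegral.integral_congr fun v _ => ?_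
      show (v * (2 * α * Λ v))⁻¹ = (2 * α)⁻¹ * (v * Λ v)⁻¹
      rw [mul_inv, mul_inv, mul_inv, mul_inv]; ring
    rw [e, inv_mul_le_iff₀ (by positivity)]
    linarith

end CorollaryTwoOne

end Literature.Probability.MarkovChains
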